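import Summits.QuantumFields.BalabanUV.Beta.GAN24.FibreArrowRows
import Summits.QuantumFields.BalabanUV.Beta.GAN24.FibreDFTDictionary

/-!
# `BalabanUV.Beta.GAN24.FibreArrowRowsBloch` — binder row G-an2-4 / (CONV-C), road P1-fibre, node N04 of `SKELETON-P1.md` (leaf P1-L04b, PART (b)):
# the rows of the Bloch fibre map `fibreFun (blochChar p) v` on the ALIAS FAMILY `k_m = kFine p m`, and the feed `adjContourSum ↦ χ̂·s♭` in modes

NOT IN PRINT; OUR PROOF ATTEMPT.  HONEST FRAMING (cell contract, verbatim): «discharging `BetaPertH` makes Bałaban's UV stability UNCONDITIONAL — a real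
constructive-QFT result; it is NOT the continuum limit and NOT the Clay problem.»  HONEST DEPENDENCY (verbatim): «continuum YM on T⁴ ⇐ BetaPertH ∧ nine spine
estimates (0/9 proved); BetaPertH ⇐ (D1) ∧ (D4) ∧ CAP+tail; G-an2-4 gates asym, D1 and NE2/3/4.»  [folklore] finite-difference / finite-Fourier bookkeeping over `ℂ`
(no estimate, no cited fact, no wall binder, no `def`).  NOT summit progress; nothing of (CONV-C)'s K-slot is discharged here.

Companion of `GAN24/FibreArrowRows` (PART (a), p200747: rows of `BlochFibreMatrix.resid` on a generic plane-wave superposition, hypothesis form) — here the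
hypotheses are DISCHARGED by leaf-16's Bloch dictionary (`GAN24/FibreDFTDictionary.cfgA_tens_blochChar`/`cfgμ_tens_blochChar`, amplitudes `ampA`, `ampμ` = the
twisted box DFT `GAN24/FibreDFT.amp` of the box data) on the alias family `kFine p m = (p + 2π·repZ m)/N`, `m ∈ (ℤ/N)^D`, COMPLEX quasi-momentum `p`.

## What is proved
* §1 `pw_natMul_unitVec`/`pw_neg_natMul_unitVec` (`pw (±k) (s•e_κ) = e^{±i k_κ s}`); **`blochChar_quo_eq_sum`**: the block phase `blochChar p (quo N x)` is the
  superposition `Σ_m χ̂(m)·pw k_m x` on ALL of `ℤ^D` with `χ̂(m) := amp p 1 m` (twisted box DFT of the constant `1`; `= N^{−D}S♭(m)` of S1a) — the dictionary at box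
  data `1`; hence **THE FEED IN MODES** `adjContourSum N (cfgφ (tens (blochChar p) v)) κ x = v_φκ · Σ_m χ̂(m)·s♭_κ(m)·pw k_m x`, `s♭_κ(m) = Σ_{s<N} pw (−k_m)(s•e_κ)
  = Σ_{s<N} e^{−i k_{m,κ} s}` (`adjContourSum_blochChar_eq_sum`, `…_eq_sum'`) — S1a's `adjContourSum ↦ χ̂·s♭`, valid at every complex `p`.
* §2 THE ROWS OF `BlochFibreMatrix.fibreFun (blochChar p) v` (`= (fibreMatrix (blochChar p)).mulVec v`, `BlochFibreMatrix.fibreMatrix_mulVec`) in the amplitudes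
  `Â = ampA p v`, `μ̂ = ampμ p v` and `φ = v ∘ inr ∘ inr`: `fibreFun_blochChar_EL` (feed in position space: `((z_κ+1) + (N−1−z_κ)e^{−ip_κ})·φ_κ`),
  **`fibreFun_blochChar_EL_modes`** (`Σ_m [2(L_m Â_mκ − ∂̂_mκ(∂̂♭_m·Â_m)) − L_m ∂̂_mκ μ̂_m − χ̂_m s♭_κ(m) φ_κ]·pw k_m (repZ z)` — the S1a EL row verbatim),
  `fibreFun_blochChar_G` (`Σ_m L_m(∂̂♭_m·Â_m)(pw k_m (repZ z) − 1)`, `z ≠ 0`), `fibreFun_blochChar_M` (`Σ_m μ̂_m·S(m)`, `S(m) = Σ_z pw k_m (repZ z)`, via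
  `blockSum_pw0_zero`), `fibreFun_blochChar_Q` (`Σ_m Â_mκ·Σ_zΣ_{s<N} pw k_m (repZ z + s•e_κ)`, via `contourSum_pw1_zero`; the product form `S·s_κ` is gan24-p1's
  `FibreSymbols.contourSum_plane`, v1.1).  With `FibreDFT.ampMat`/`sum_pw_neg_mul_pw_kFine` (DFT in the ROW index) this is the input of leaf P1-L04c (arrow matrix).
Unit `b2b-balaban-gan24-formalise-leaf-06` (G-an2-4 formalisation swarm), 2026-08-19.
-/

noncomputable section

open Complex Finset
open scoped BigOperators
open Literature.MathematicalPhysics.QuantumFieldTheory.Balaban1983to89.Beta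
open Literature.MathematicalPhysics.QuantumFieldTheory.LatticeForm (repZ quo)
open Literature.Probability.LatticeModels (TorusSite)
open AffineAveraging (Site Form0 Form1 unitVec unitVec_apply blockSum contourSum)
open BlochFibreUniqueness (adjContourSum adjContourSum_apply)
open BlochFibreMatrix (Idx cfgφ tens resid blochChar)
open Summit.QuantumFields.BalabanUV.Beta.GAN24.FibreSymbols (pw dhat dflat lapSym pw0 pw1)
open Summit.QuantumFields.BalabanUV.Beta.GAN24.FibreBlockSolve (dot)
open Summit.QuantumFields.BalabanUV.Beta.GAN24.FibreDFT (pw_zero_site blochChar_eq_pw)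
open Summit.QuantumFields.BalabanUV.Beta.GAN24.FibreArrowRows

namespace Summit.QuantumFields.BalabanUV.Beta.GAN24.FibreArrowRowsBloch

variable {D : ℕ}

/-! ## §1 The alias family `k_m = kFine p m`: the block phase and the feed in modes -/

section Modes

open FibreDFT (kFine amp pw_sub_site pw_neg)
open FibreDFTDictionary (ampA ampμ cfgA_tens_blochChar cfgμ_tens_blochChar)

variable {N : ℕ} [NeZero N]

omit [NeZero N] in
/-- [folklore] A plane wave read at `s` steps along `e_κ`: `pw k (s•e_κ) = e^{i k_κ s}`. -/
theorem pw_natMul_unitVec (k : Fin D → ℂ) (κ : Fin D) (s : ℕ) : pw k ((s : ℤ) • unitVec κ) = cexp (I * k κ * s) := by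
  induction s with
  | zero => simp [pw_zero_site]
  | succ n ih =>
    rw [Nat.cast_succ, add_smul, one_smul, FibreSymbols.pw_add_unitVec, ih, ← Complex.exp_add]
    push_cast
    ring_nf

omit [NeZero N] in
/-- [folklore] The reflected reading `pw (−k) (s•e_κ) = e^{−i k_κ s}` (the summand of `s♭_κ`). -/
theorem pw_neg_natMul_unitVec (k : Fin D → ℂ) (κ : Fin D) (s : ℕ) : pw (-k) ((s : ℤ) • unitVec κ) = cexp (-(I * k κ * s)) := by
  rw [pw_natMul_unitVec, Pi.neg_apply]; ring_nf

/-- [folklore] **THE BLOCK PHASE IN MODES.**  On all of `ℤ^D`: `blochChar p (quo N x) = Σ_m χ̂(m) · pw k_m x`, `χ̂(m) = amp p 1 m` — the Bloch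
dictionary of leaf-16 (`cfgμ_tens_blochChar`) applied to the constant box data `1` (the block phase is `blochChar p`-Bloch and `≡ 1` on the box). -/
theorem blochChar_quo_eq_sum (p : Fin D → ℂ) (x : Site D) :
    blochChar p (quo N x) = ∑ m : TorusSite D N, amp p (1 : TorusSite D N → ℂ) m * pw (kFine p m) x := by
  have h := cfgμ_tens_blochChar p (fun _ : Idx D N => (1 : ℂ)) x
  have h1 : BlochFibreMatrix.cfgμ (tens (⇑(blochChar p)) fun _ : Idx D N => (1 : ℂ)) x = blochChar p (quo N x) := by
    show blochChar p (quo N x) * 1 = _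
    rw [mul_one]
  rw [h1] at h
  exact h

/-- [folklore] **THE FEED IN MODES** (S1a: `adjContourSum ↦ χ̂·s♭`), at every fine point `x ∈ ℤ^D`:
`adjContourSum N (cfgφ (tens (blochChar p) v)) κ x = v_φκ · Σ_m χ̂(m) · (Σ_{s<N} pw (−k_m) (s•e_κ)) · pw k_m x`. -/
theorem adjContourSum_blochChar_eq_sum (p : Fin D → ℂ) (v : Idx D N → ℂ) (κ : Fin D) (x : Site D) :
    adjContourSum N (cfgφ (tens (⇑(blochChar p)) v)) κ x
      = v (Sum.inr (Sum.inr κ)) * ∑ m : TorusSite D N,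
          amp p (1 : TorusSite D N → ℂ) m * (∑ s ∈ Finset.range N, pw (-kFine p m) ((s : ℤ) • unitVec κ)) * pw (kFine p m) x := by
  rw [adjContourSum_apply]
  simp only [cfgφ_tens, blochChar_quo_eq_sum, Finset.sum_mul, Finset.mul_sum]
  rw [Finset.sum_comm]
  refine Finset.sum_congr rfl fun m _ => ?_
  refine Finset.sum_congr rfl fun s _ => ?_
  rw [pw_sub_site]
  ring

/-- [folklore] The feed in modes with the geometric summands written out: `s♭_κ(m) = Σ_{s<N} e^{−i k_{m,κ} s}`. -/
theorem adjContourSum_blochChar_eq_sum' (p : Fin D → ℂ) (v : Idx D N → ℂ) (κ : Fin D) (x : Site D) :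
    adjContourSum N (cfgφ (tens (⇑(blochChar p)) v)) κ x
      = v (Sum.inr (Sum.inr κ)) * ∑ m : TorusSite D N,
          amp p (1 : TorusSite D N → ℂ) m * (∑ s ∈ Finset.range N, cexp (-(I * kFine p m κ * s))) * pw (kFine p m) x := by
  rw [adjContourSum_blochChar_eq_sum]
  simp only [pw_neg_natMul_unitVec]

end Modes

/-! ## §2 The rows of the Bloch fibre map `fibreFun (blochChar p) v` in amplitudes -/

section FibreRows

open FibreDFT (kFine amp)
open FibreDFTDictionary (ampA ampμ cfgA_tens_blochChar cfgμ_tens_blochChar)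
open BlochFibreMatrix (fibreFun cfgFun cfgA cfgμ)
open BlochFibreUniqueness (bsum blockSum_zero_eq_bsum sum_box_toSite_eq_bsum)

variable {N : ℕ} [NeZero N]

/-- [folklore] The Bloch fibre map is the residual of the Bloch configuration (definitional). -/
theorem fibreFun_eq_resid (c : Site D → ℂ) (v : Idx D N → ℂ) :
    fibreFun c v = resid (cfgA (tens c v)) (cfgφ (tens c v)) (cfgμ (tens c v)) := rfl

/-- [folklore] **EL ROWS OF THE FIBRE MAP** at quasi-momentum `p` (feed in position space): with `Â = ampA p v`, `μ̂ = ampμ p v`, `k_m = kFine p m`,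
`fibreFun (blochChar p) v (inl (κ,z)) = Σ_m (2(L_m Â_mκ − ∂̂_mκ(∂̂♭_m·Â_m)) − L_m ∂̂_mκ μ̂_m)·pw k_m (repZ z) − ((z_κ+1) + (N−1−z_κ)e^{−ip_κ})·v_φκ`. -/
theorem fibreFun_blochChar_EL (p : Fin D → ℂ) (v : Idx D N → ℂ) (κ : Fin D) (z : TorusSite D N) :
    fibreFun (⇑(blochChar p)) v (Sum.inl (κ, z))
      = (∑ m : TorusSite D N, (2 * (lapSym (kFine p m) * ampA p v m κ - dhat (kFine p m) κ * dot (dflat (kFine p m)) (ampA p v m))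
            - lapSym (kFine p m) * dhat (kFine p m) κ * ampμ p v m) * pw (kFine p m) (repZ z))
        - ((((z κ).val : ℂ) + 1) + ((N : ℂ) - 1 - (z κ).val) * cexp (-(I * p κ))) * v (Sum.inr (Sum.inr κ)) := by
  rw [fibreFun_eq_resid]
  exact resid_spw_EL_blochChar (cfgA_tens_blochChar p v) (cfgμ_tens_blochChar p v) p v κ z

/-- [folklore] **EL ROWS OF THE FIBRE MAP, EVERYTHING IN MODES** — the S1a EL row: `Σ_m [2(L_m Â_mκ − ∂̂_mκ(∂̂♭_m·Â_m)) − L_m∂̂_mκ μ̂_m − χ̂_m s♭_κ(m) φ_κ]·pw k_m (repZ z)`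
with `χ̂_m = amp p 1 m`, `s♭_κ(m) = Σ_{s<N} pw (−k_m) (s•e_κ)`, `φ_κ = v (inr (inr κ))`. -/
theorem fibreFun_blochChar_EL_modes (p : Fin D → ℂ) (v : Idx D N → ℂ) (κ : Fin D) (z : TorusSite D N) :
    fibreFun (⇑(blochChar p)) v (Sum.inl (κ, z))
      = ∑ m : TorusSite D N, ((2 * (lapSym (kFine p m) * ampA p v m κ - dhat (kFine p m) κ * dot (dflat (kFine p m)) (ampA p v m))
            - lapSym (kFine p m) * dhat (kFine p m) κ * ampμ p v m)
            - amp p (1 : TorusSite D N → ℂ) m * (∑ s ∈ Finset.range N, pw (-kFine p m) ((s : ℤ) • unitVec κ)) * v (Sum.inr (Sum.inr κ)))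
          * pw (kFine p m) (repZ z) := by
  rw [fibreFun_eq_resid, resid_spw_EL (cfgA_tens_blochChar p v) (cfgμ_tens_blochChar p v), adjContourSum_blochChar_eq_sum, Finset.mul_sum,
    ← Finset.sum_sub_distrib]
  exact Finset.sum_congr rfl fun m _ => by ring

/-- [folklore] **G ROWS OF THE FIBRE MAP** (`z ≠ 0`): `Σ_m L_m (∂̂♭_m·Â_m)·(pw k_m (repZ z) − 1)`. -/
theorem fibreFun_blochChar_G (p : Fin D → ℂ) (v : Idx D N → ℂ) {z : TorusSite D N} (hz : z ≠ 0) :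
    fibreFun (⇑(blochChar p)) v (Sum.inr (Sum.inl z))
      = ∑ m : TorusSite D N, lapSym (kFine p m) * dot (dflat (kFine p m)) (ampA p v m) * (pw (kFine p m) (repZ z) - 1) := by
  rw [fibreFun_eq_resid]
  exact resid_spw_G (cfgA_tens_blochChar p v) _ _ hz

omit [NeZero N] in
/-- [folklore] The block sum of a single scalar plane wave at the origin block, as a torus sum: `blockSum N (pw0 k c) 0 = c · Σ_z pw k (repZ z)`
(`= c·S(k)`; product form `Π_μ gsum` is `FibreSymbols.blockSum_plane`). -/
theorem blockSum_pw0_zero [NeZero N] (k : Fin D → ℂ) (c : ℂ) :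
    blockSum N (pw0 k c) 0 = c * ∑ z : TorusSite D N, pw k (repZ z) := by
  rw [blockSum_zero_eq_bsum, bsum, Finset.mul_sum]
  rfl

/-- [folklore] **M ROW OF THE FIBRE MAP**: `Σ_m μ̂_m · S(m)`, `S(m) = Σ_z pw k_m (repZ z)`. -/
theorem fibreFun_blochChar_M (p : Fin D → ℂ) (v : Idx D N → ℂ) :
    fibreFun (⇑(blochChar p)) v (Sum.inr (Sum.inl 0))
      = ∑ m : TorusSite D N, ampμ p v m * ∑ z : TorusSite D N, pw (kFine p m) (repZ z) := by
  rw [fibreFun_eq_resid, resid_spw_M (cfgμ_tens_blochChar p v)]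
  exact Finset.sum_congr rfl fun m _ => blockSum_pw0_zero _ _

omit [NeZero N] in
/-- [folklore] The contour sum of a single 1-form plane wave at the origin block, as a torus double sum:
`contourSum N (pw1 k a) κ 0 = a_κ · Σ_z Σ_{s<N} pw k (repZ z + s•e_κ)` (product form `S·s_κ` is `FibreSymbols.contourSum_plane`). -/
theorem contourSum_pw1_zero [NeZero N] (k : Fin D → ℂ) (a : Fin D → ℂ) (κ : Fin D) :
    contourSum N (pw1 k a) κ 0
      = a κ * ∑ z : TorusSite D N, ∑ s ∈ Finset.range N, pw k (repZ z + (s : ℤ) • unitVec κ) := by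
  have h := sum_box_toSite_eq_bsum (N := N) (fun y : Site D => ∑ s ∈ Finset.range N, pw1 k a κ (0 + y + (s : ℤ) • unitVec κ))
  unfold contourSum
  rw [smul_zero]
  refine h.trans ?_
  rw [bsum, Finset.mul_sum]
  refine Finset.sum_congr rfl fun z _ => ?_
  rw [Finset.mul_sum]
  refine Finset.sum_congr rfl fun s _ => ?_
  simp only [pw1, zero_add]

/-- [folklore] **Q ROWS OF THE FIBRE MAP**: `Σ_m Â_mκ · Σ_z Σ_{s<N} pw k_m (repZ z + s•e_κ)` (`= Σ_m S(m) s_κ(m) Â_mκ` of S1a). -/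
theorem fibreFun_blochChar_Q (p : Fin D → ℂ) (v : Idx D N → ℂ) (κ : Fin D) :
    fibreFun (⇑(blochChar p)) v (Sum.inr (Sum.inr κ))
      = ∑ m : TorusSite D N, ampA p v m κ * ∑ z : TorusSite D N, ∑ s ∈ Finset.range N, pw (kFine p m) (repZ z + (s : ℤ) • unitVec κ) := by
  rw [fibreFun_eq_resid, resid_spw_Q (cfgA_tens_blochChar p v)]
  exact Finset.sum_congr rfl fun m _ => contourSum_pw1_zero _ _ _

end FibreRows

end Summit.QuantumFields.BalabanUV.Beta.GAN24.FibreArrowRowsBloch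

end
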